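import Literature.Analysis.FluidPDE.Tao2016AveragedNS.SplitCascadeBlowupDynamics
import Literature.Analysis.FluidPDE.TaoCascadeBlowupDynamicsWith
import HarnessLib

/-!
# Tao's cascade ODE with the squared modes doubled, I-bis: the reduction of "no global solution of
# the split system" to an inductive step, with a GENERAL coefficient `γ` in (6.17)

T. Tao, *Finite time blowup for an averaged three-dimensional Navier–Stokes equation*, J. Amer.
Math. Soc. **29** (2016) 601–674 = arXiv:1402.0290v3, §6.2 Prop. 6.3 (6.11)–(6.27) and the last
paragraph of §6.2, §6.3 Prop. 6.4 [`Tao2016AveragedNS`]; the blog erratum replacing the coefficient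
`10⁻⁵exp(-K¹⁰)` of (6.17) by `10⁻⁵exp(-K¹⁰/2)` [`TaoBlog2014AveragedNSErratum`], as recorded in the
tree's `TaoCascadeBlowupDynamicsWith.lean` (`BlowupCheckpointsWith γ`: "the printed induction closes
only with the weaker constant").

HONEST FRAMING (cell harvest/h2-tao-ladder, rung 1 of a ladder of MODEL equations; RUNG1-HANDOFF h4 /
R1-b): `SplitCascadeBlowupDynamics.lean` reduces "no global solution of `SplitODESystem`" to an
inductive step phrased with the PRINTED checkpoint bounds `BlowupCheckpoints` (coefficient
`10⁻⁵exp(-K¹⁰)` in (6.17)). Since the tree's own proof of Theorem 6.2 runs the induction with a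
general coefficient `γ(K)` (and closes it for `γ K = 10⁻⁵exp(-K¹⁰/2)`), the USABLE form of the split
reduction is the one below, with `BlowupCheckpointsWith (γ K)` on the symmetric amplitudes and an
arbitrary invariant `P`: `SplitODESystem.false_of_inductiveStepWith`,
`splitBlowupDynamicsStepWith γ P` (a predicate, not asserted) and
`noGlobalSplit_of_splitBlowupDynamicsStepWith` (Theorem 6.2♯ ⇐ Prop. 6.4♯ with coefficient `γ ≥ 0`).
Nothing here proves the step; nothing concerns Navier–Stokes.
-/

noncomputable section

open Set

namespace Literature.Analysis.FluidPDE.Tao2016AveragedNS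

open TaoCascade

section Checkpoints

variable {γ ε₀ K ε C₁ C₂ : ℝ} {n₀ : ℤ} {S : Fin 4 → ℤ → ℝ → ℝ} {Z : Fin 3 → ℤ → ℝ → ℝ}
  {E : ℤ → ℝ → ℝ}

/-- **The last paragraph of Tao's §6.2 for the split system, any coefficient `γ` in (6.17)**: if
`(S, Z, E)` obeys (6.0♯)–(6.8♯) and the checkpoint bounds (6.11)–(6.27) with coefficient `γ`
(`TaoCascade.BlowupCheckpointsWith γ`, read on `(S, E)`) hold up to every level `N ≥ n₀`,
contradiction (lifespans sum to a uniform `T(ε₀,n₀)` while `S_{a,N}(t_N) = e_N ≥ (1+ε₀)^{-(N-n₀)/100}`,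
against (6.0♯)). [cite: Tao2016AveragedNS, §6.2 p. 53] -/
theorem SplitODESystem.false_of_blowupCheckpointsWith (hε₀ : 0 < ε₀)
    (hsol : SplitODESystem ε₀ K ε C₁ C₂ n₀ S Z E)
    (hdyn : ∀ N : ℤ, n₀ ≤ N → ∃ t e : ℤ → ℝ, BlowupCheckpointsWith γ ε₀ K ε n₀ N S E t e) :
    False := by
  have hq1 : (1 : ℝ) < 1 + ε₀ := by linarith
  have hq0 : (0 : ℝ) < 1 + ε₀ := by linarith
  have hρ : (1 + ε₀) ^ (-(249 : ℝ) / 100) < 1 :=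
    Real.rpow_lt_one_of_one_lt_of_neg hq1 (by norm_num)
  set T : ℝ := 100 * (1 + ε₀) ^ (-(5 : ℝ) * n₀ / 2) / (1 - (1 + ε₀) ^ (-(249 : ℝ) / 100)) + 1
    with hT
  have hTpos : 0 < T := by
    have : 0 ≤ 100 * (1 + ε₀) ^ (-(5 : ℝ) * n₀ / 2) / (1 - (1 + ε₀) ^ (-(249 : ℝ) / 100)) :=
      div_nonneg (by positivity) (by linarith)
    linarith
  obtain ⟨M, hM⟩ := hsol.apriori_S T hTpos
  have hbound : ∀ N : ℤ, n₀ ≤ N → (1 + ε₀) ^ ((999 : ℝ) / 100 * N + n₀ / 100) ≤ M := by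
    intro N hN
    obtain ⟨t, e, h⟩ := hdyn N hN
    obtain ⟨ht0, htT⟩ := h.time_le_uniform hε₀ hN le_rfl
    have hst := h.state N hN le_rfl
    have hMN := hM (t N) ⟨ht0, by linarith⟩ 0 N
    rw [hst.x1_eq, abs_of_pos hst.pos] at hMN
    have heN := h.rpow_le_amp hε₀ hN le_rfl
    calc (1 + ε₀) ^ ((999 : ℝ) / 100 * N + n₀ / 100)
        = (1 + ε₀) ^ ((10 : ℝ) * N) * (1 + ε₀) ^ (-((N : ℝ) - n₀) / 100) := by
          have hexp : (999 : ℝ) / 100 * N + n₀ / 100 = (10 : ℝ) * N + -((N : ℝ) - n₀) / 100 := by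
            ring
          rw [hexp, Real.rpow_add hq0]
      _ ≤ (1 + (1 + ε₀) ^ ((10 : ℝ) * N)) * e N := by
          apply mul_le_mul _ heN (Real.rpow_pos_of_pos hq0 _).le (by positivity)
          linarith [Real.rpow_pos_of_pos hq0 ((10 : ℝ) * N)]
      _ ≤ M := hMN
  obtain ⟨N, hN⟩ : ∃ N : ℤ, n₀ ≤ N ∧ (max 1 (M / ε₀) + 1 : ℝ) ≤ (999 : ℝ) / 100 * N + n₀ / 100 := by
    obtain ⟨N, hN⟩ := exists_int_gt (max (n₀ : ℝ) ((max 1 (M / ε₀) + 1 - n₀ / 100) * 100 / 999))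
    refine ⟨N, ?_, ?_⟩
    · exact_mod_cast ((le_max_left _ _).trans_lt hN).le
    · have := (le_max_right _ _).trans_lt hN
      nlinarith
  have hp : (1 : ℝ) ≤ (999 : ℝ) / 100 * N + n₀ / 100 := by
    linarith [le_max_left (1 : ℝ) (M / ε₀)]
  have hbern := one_add_mul_self_le_rpow_one_add (s := ε₀) (by linarith) hp
  have hle := hbound N hN.1
  have hMε : M < ((999 : ℝ) / 100 * N + n₀ / 100) * ε₀ := by
    have h2 : M / ε₀ < (999 : ℝ) / 100 * N + n₀ / 100 := by
      linarith [le_max_right (1 : ℝ) (M / ε₀)]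
    rwa [div_lt_iff₀ hε₀] at h2
  linarith

/-- **Base case, any coefficient `γ ≥ 0`**: `t_{n₀} = 0`, `e_{n₀} = 1` and (6.15)–(6.20) with
coefficient `γ` at `n = n₀`, from the datum (6.6♯). [cite: Tao2016AveragedNS, §6.3 p. 53] -/
theorem SplitODESystem.blowupCheckpointsWith_base (hsol : SplitODESystem ε₀ K ε C₁ C₂ n₀ S Z E)
    (hγ : 0 ≤ γ) (hε₀ : 0 < ε₀) (hK : 0 < K) (hε : 0 < ε) :
    BlowupCheckpointsWith γ ε₀ K ε n₀ n₀ S E (fun _ => 0) (fun _ => 1) where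
  t_init := rfl
  e_init := rfl
  state n hn hn' := by
    obtain rfl : n = n₀ := le_antisymm hn' hn
    refine ⟨one_pos, by simp [hsol.init_S], ?_, ?_, ?_, ?_, ?_⟩
    · simp [hsol.init_S]; positivity
    · simp [hsol.init_S]; positivity
    · simp [hsol.init_S]; positivity
    · simp [hsol.init_S]; positivity
    · simp [hsol.init_E]; positivity
  step n hn hn' := absurd hn' (not_le.mpr hn)

/-- **The induction of §6.3 for the split system with coefficient `γ ≥ 0` in (6.17) and an arbitrary
family of extra checkpoint clauses `P` (PROVED).** If `P` holds at the datum and every level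
`N ≥ n₀` carrying `BlowupCheckpointsWith γ` on `(S, E)` and `P N` extends to level `N+1`
(`StateBoundsWith γ ∧ StepBounds` and `P (N+1)`), the split solution cannot exist. This is the
reduction the cell's step must target (the tree's proof of Theorem 6.2 closes the induction only for
`γ K = 10⁻⁵exp(-K¹⁰/2)`, `blowupDynamicsStepCorrected`). [cite: Tao2016AveragedNS, §6.3 p. 53] -/
theorem SplitODESystem.false_of_inductiveStepWith (hsol : SplitODESystem ε₀ K ε C₁ C₂ n₀ S Z E)
    (hγ : 0 ≤ γ) (hε₀ : 0 < ε₀) (hK : 0 < K) (hε : 0 < ε) (P : ℤ → (ℤ → ℝ) → (ℤ → ℝ) → Prop)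
    (hbase : P n₀ (fun _ => 0) (fun _ => 1))
    (hstep : ∀ N : ℤ, n₀ ≤ N → ∀ t e : ℤ → ℝ, BlowupCheckpointsWith γ ε₀ K ε n₀ N S E t e →
      P N t e → ∃ s a : ℝ, StateBoundsWith γ ε₀ K ε n₀ S E (N + 1) s a ∧
        StepBounds ε₀ K ε S E (N + 1) (t N) s (e N) a ∧
        P (N + 1) (Function.update t (N + 1) s) (Function.update e (N + 1) a)) : False := by
  refine hsol.false_of_blowupCheckpointsWith (γ := γ) hε₀ fun N hNn => ?_
  suffices h : ∃ t e : ℤ → ℝ, BlowupCheckpointsWith γ ε₀ K ε n₀ N S E t e ∧ P N t e by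
    obtain ⟨t, e, hce, -⟩ := h
    exact ⟨t, e, hce⟩
  induction N, hNn using Int.leInduction with
  | base => exact ⟨_, _, hsol.blowupCheckpointsWith_base hγ hε₀ hK hε, hbase⟩
  | succ N hmn ih =>
    obtain ⟨t, e, hce, hP⟩ := ih
    obtain ⟨s, a, hst, hsp, hP'⟩ := hstep N hmn t e hce hP
    exact ⟨_, _, hce.extend hmn hst hsp, hP'⟩

end Checkpoints

/-! ## The inductive step with coefficient `γ`, and Theorem 6.2♯ from it -/

/-- **The split analogue of Prop. 6.4 with a general `X₃`-coefficient `γ = γ(K)` in (6.17)/(6.32),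
relative to a family `P` of asymmetry clauses — the cell's OBLIGATION in its usable form (a
predicate, not asserted).** Same quantifier shape as `TaoCascade.blowupDynamicsStepWith γ`, for
`SplitODESystem`, with `P … N t e` carried from level `N` to level `N+1`. The corrected coefficient
of the tree's proof of Theorem 6.2 is `γ K = 10⁻⁵exp(-K¹⁰/2)`. [cite: Tao2016AveragedNS, §6.3 Prop. 6.4] -/
def splitBlowupDynamicsStepWith (γ : ℝ → ℝ)
    (P : ℝ → ℝ → ℝ → ℤ → (Fin 4 → ℤ → ℝ → ℝ) → (Fin 3 → ℤ → ℝ → ℝ) → (ℤ → ℝ → ℝ) →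
      ℤ → (ℤ → ℝ) → (ℤ → ℝ) → Prop) : Prop :=
  ∀ ε₀ : ℝ, 0 < ε₀ → ε₀ < 1 →
    ∃ K₀ : ℝ, ∀ K : ℝ, K₀ ≤ K → 0 < K →
      ∃ e₀ : ℝ, 0 < e₀ ∧ ∀ ε : ℝ, 0 < ε → ε ≤ e₀ →
        ∀ C₁ C₂ : ℝ, 0 ≤ C₁ → 0 ≤ C₂ →
          ∃ N₀ : ℤ, ∀ n₀ : ℤ, N₀ ≤ n₀ →
            ∀ (S : Fin 4 → ℤ → ℝ → ℝ) (Z : Fin 3 → ℤ → ℝ → ℝ) (E : ℤ → ℝ → ℝ),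
              SplitODESystem ε₀ K ε C₁ C₂ n₀ S Z E →
              ∀ N : ℤ, n₀ ≤ N → ∀ t e : ℤ → ℝ, BlowupCheckpointsWith (γ K) ε₀ K ε n₀ N S E t e →
                P ε₀ K ε n₀ S Z E N t e →
                ∃ s a : ℝ, StateBoundsWith (γ K) ε₀ K ε n₀ S E (N + 1) s a ∧
                  StepBounds ε₀ K ε S E (N + 1) (t N) s (e N) a ∧
                  P ε₀ K ε n₀ S Z E (N + 1) (Function.update t (N + 1) s)
                    (Function.update e (N + 1) a)

/-- **Theorem 6.2♯ ⇐ Proposition 6.4♯ with coefficient `γ ≥ 0` (PROVED reduction).** If, for some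
`γ` with `γ K ≥ 0` for `K > 0` and some family `P` of asymmetry clauses satisfied by every split
solution at its datum, `splitBlowupDynamicsStepWith γ P` holds, then the split system has no global
solution in Tao's regime (quantifier block of `TaoCascade.noGlobalODESolution` for `SplitODESystem`;
thresholds of the step). [cite: Tao2016AveragedNS, §6.2–6.3 p. 53] -/
theorem noGlobalSplit_of_splitBlowupDynamicsStepWith {γ : ℝ → ℝ}
    {P : ℝ → ℝ → ℝ → ℤ → (Fin 4 → ℤ → ℝ → ℝ) → (Fin 3 → ℤ → ℝ → ℝ) → (ℤ → ℝ → ℝ) →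
      ℤ → (ℤ → ℝ) → (ℤ → ℝ) → Prop}
    (hγ : ∀ K, 0 < K → 0 ≤ γ K)
    (hbase : ∀ (ε₀ K ε C₁ C₂ : ℝ) (n₀ : ℤ) (S : Fin 4 → ℤ → ℝ → ℝ) (Z : Fin 3 → ℤ → ℝ → ℝ)
      (E : ℤ → ℝ → ℝ), SplitODESystem ε₀ K ε C₁ C₂ n₀ S Z E →
        P ε₀ K ε n₀ S Z E n₀ (fun _ => 0) (fun _ => 1))
    (h : splitBlowupDynamicsStepWith γ P) :
    ∀ ε₀ : ℝ, 0 < ε₀ → ε₀ < 1 →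
      ∃ K₀ : ℝ, ∀ K : ℝ, K₀ ≤ K → 0 < K →
        ∃ e₀ : ℝ, 0 < e₀ ∧ ∀ ε : ℝ, 0 < ε → ε ≤ e₀ →
          ∀ C₁ C₂ : ℝ, 0 ≤ C₁ → 0 ≤ C₂ →
            ∃ N₀ : ℤ, ∀ n₀ : ℤ, N₀ ≤ n₀ →
              ¬ ∃ (S : Fin 4 → ℤ → ℝ → ℝ) (Z : Fin 3 → ℤ → ℝ → ℝ) (E : ℤ → ℝ → ℝ),
                SplitODESystem ε₀ K ε C₁ C₂ n₀ S Z E := by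
  intro ε₀ hε₀ hε₀1
  obtain ⟨K₀, hK⟩ := h ε₀ hε₀ hε₀1
  refine ⟨K₀, fun K hK₀K hKpos => ?_⟩
  obtain ⟨e₀, he₀, hε⟩ := hK K hK₀K hKpos
  refine ⟨e₀, he₀, fun ε hεpos hεle C₁ C₂ hC₁ hC₂ => ?_⟩
  obtain ⟨N₀, hN⟩ := hε ε hεpos hεle C₁ C₂ hC₁ hC₂
  refine ⟨N₀, fun n₀ hn₀ => ?_⟩
  rintro ⟨S, Z, E, hsol⟩
  exact hsol.false_of_inductiveStepWith (hγ K hKpos) hε₀ hKpos hεpos (P ε₀ K ε n₀ S Z E)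
    (hbase ε₀ K ε C₁ C₂ n₀ S Z E hsol) (hN n₀ hn₀ S Z E hsol)

end Literature.Analysis.FluidPDE.Tao2016AveragedNS
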